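import Summits.ValiantsHypothesis.ValiantsHypothesis.Theorems.KPlusLogSqLawTropicalShiftLadderDefs
import Summits.ValiantsHypothesis.ValiantsHypothesis.Theorems.KPlusLogSqLawTropicalShiftSquare

/-!
# Route «KPlusLogSqLaw» — SHIFT-LADDER, part 1: per-incidence scores and the domination inequalities

HONEST FRAMING.  Proof file (pure theorems) of the helper chain `--supports` the crux
`Summit.ValiantsHypothesis.ValiantsHypothesis.Theses.KPlusLogSqLaw.TropicalB` (item `stmt-ValiantsHypothesis-19771`, route `KPlusLogSqLaw`;
cell `pub-symmetroid`, seat val-sym-trop-p5 g8, 2026-08-27); the design is described in `…TropicalShiftLadderDefs.lean`.  Nothing here asserts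
`TropicalB`, `WeakLifting`, `KPlusLogSqLaw`, `MatrixDescartes` or anything about `VP ≠ VNP`.

THE ARGUMENT (SHIFT-SQUARE's, with `A + 1` low rungs).  Digits: `lo l ≤ A`, `hi l ≤ 1`, `l = lo l + (A+1)·hi l` (`eq_of_digits`).  The
zero-sum gauge `θ·κ·shift − θ·D·[wrap]` (`sum_redistribute`) writes the tropical weight of ANY Leibniz term as `Σ_b φ_θ(σ b, b, λ b)`
(`tropWeight_eq_sum_phi`); for a PRESENT incidence `hi·D + κ·shift − D·[wrap] = κ·(effective shift)` (`gauge_identity`), so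
`φ = g_θ(q) + bonus(θ, q, b, lo)` (`phi_present`).  The grid incidence of column `b` has digits `(lvl a b, [m ≤ b + p])` (`lo_lam`, `hi_lam`;
`lvl a b ≤ A` for `a ≤ A·m`, `lvl_le`), effective shift `p` (`eshift_cterm`) and score `g_θ(p) + bonus(θ, p, b, lvl a b)` (`phi_cterm`).  At
`θ(p,a) = 2W·p + 2a + 1`: `g(p) − g(q) > 2AW·(p − q)` for `q < p` (`gval_gap_of_lt`, `κ = 2AW + 1`), `g(p) − g(q) > 0` for `q > p` and every
`a ≤ A·m` (`gval_gap_of_gt`); the bonus at another shift differs by `j·2W·(p − q)` (`bonus_shift`), and AT the phase's shift the grid rung is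
the unique best rung: `bonus(j) − bonus(j') = (j − j')(2(a − b) − 1 − m(j + j' − 1))` (`bonus_sub`) with `(lvl−1)·m + b < a ≤ lvl·m + b`
(`lvl_spec`) gives `bonus(j') < bonus(lvl)` for every `j' ≠ lvl` (`bonus_le_lvl`, `bonus_lt_lvl`).  Part 2 (`…TropicalShiftLadderChain.lean`) identifies an incidence by its effective shift (`cell_of_eshift_eq`) and sums this into dominance.
-/

set_option linter.dupNamespace false
set_option autoImplicit false

namespace Summit.ValiantsHypothesis.ValiantsHypothesis.Theorems.LacunarySymmetroidMatrixDescartes.TropicalCensus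

open Summit.ValiantsHypothesis.ValiantsHypothesis.Theorems.MatrixDescartes.Negative
open scoped BigOperators
open Finset

namespace ShiftLadder

open ShiftThree (shiftZ)
open ShiftSquare (rot)

variable (A n : ℕ)


/-! ### the two digits of a class -/

/-- the high bit is `0` or `1`. -/
theorem hi_le_one (l : Fin (2 * A + 2)) : hi A l ≤ 1 := by
  unfold hi
  have hl := l.isLt
  have : (l : ℕ) / (A + 1) < 2 := Nat.div_lt_of_lt_mul (by linarith)
  omega

/-- the low level is at most `A`. -/
theorem lo_le (l : Fin (2 * A + 2)) : lo A l ≤ A := by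
  unfold lo
  have := Nat.mod_lt (l : ℕ) (show 0 < A + 1 by omega)
  omega

/-- digit decomposition `l = lo l + (A+1)·hi l`. -/
theorem lo_add_hi (l : Fin (2 * A + 2)) : lo A l + (A + 1) * hi A l = (l : ℕ) := by
  unfold lo hi
  exact Nat.mod_add_div _ _

/-- two classes with the same digits are equal. -/
theorem eq_of_digits {l l' : Fin (2 * A + 2)} (h1 : lo A l = lo A l') (h2 : hi A l = hi A l') : l = l' := by
  apply Fin.ext
  rw [← lo_add_hi A l, ← lo_add_hi A l', h1, h2]

/-- the exponent in digit form (cast to `ℤ`). -/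
theorem dd_cast (l : Fin (2 * A + 2)) : (dd A n l : ℤ) = (lo A l : ℤ) + (hi A l : ℤ) * (bigD A n : ℤ) := by
  unfold dd; push_cast; ring

/-- `D = m·κ`. -/
theorem bigD_cast : (bigD A n : ℤ) = ((n : ℤ) + 1) * (kap A n : ℤ) := by
  unfold bigD; push_cast; ring

/-- `κ = 2A·W + 1`. -/
theorem kap_cast : (kap A n : ℤ) = 2 * (A : ℤ) * (width A n : ℤ) + 1 := by
  unfold kap; push_cast; ring

/-- `W = A·m + 1`. -/
theorem width_cast : (width A n : ℤ) = (A : ℤ) * ((n : ℤ) + 1) + 1 := by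
  unfold width; push_cast; ring

/-! ### the gauge -/

/-- **zero-sum redistribution**: `Σ_b (κ·shift(σ b, b) − D·[σ b < b]) = 0` for every permutation. -/
theorem sum_redistribute (σ : Equiv.Perm (Fin (n + 1))) :
    ∑ b, ((kap A n : ℤ) * shiftZ n (σ b) b - (bigD A n : ℤ) * (if ((σ b : Fin (n + 1)) : ℕ) < (b : ℕ) then 1 else 0)) = 0 := by
  have hD := bigD_cast A n
  have h1 : ∀ b, ((kap A n : ℤ) * shiftZ n (σ b) b -
      (bigD A n : ℤ) * (if ((σ b : Fin (n + 1)) : ℕ) < (b : ℕ) then 1 else 0))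
      = (kap A n : ℤ) * (((σ b : Fin (n + 1)) : ℕ) : ℤ) - (kap A n : ℤ) * ((b : ℕ) : ℤ) := by
    intro b
    unfold ShiftThree.shiftZ
    rw [hD]
    split_ifs with h <;> ring
  rw [Finset.sum_congr rfl (fun b _ => h1 b), Finset.sum_sub_distrib]
  have h2 : ∑ b, (kap A n : ℤ) * (((σ b : Fin (n + 1)) : ℕ) : ℤ) = ∑ b : Fin (n + 1), (kap A n : ℤ) * ((b : ℕ) : ℤ) :=
    Equiv.sum_comp σ (fun b : Fin (n + 1) => (kap A n : ℤ) * ((b : ℕ) : ℤ))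
  rw [h2, sub_self]

/-- the tropical weight is the sum of the corrected per-incidence scores. -/
theorem tropWeight_eq_sum_phi (θ : ℤ) (q : Equiv.Perm (Fin (n + 1)) × (Fin (n + 1) → Fin (2 * A + 2))) :
    tropWeight (dd A n) (vv A n) θ q = ∑ b, phi A n θ (q.1 b) b (q.2 b) := by
  unfold tropWeight phi
  have h0 := sum_redistribute A n q.1
  rw [Finset.sum_sub_distrib, Finset.sum_add_distrib, Finset.sum_sub_distrib, ← Finset.mul_sum]
  have h3 : ∑ b, θ * (kap A n : ℤ) * shiftZ n (q.1 b) b -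
      ∑ b, θ * (bigD A n : ℤ) * (if ((q.1 b : Fin (n + 1)) : ℕ) < (b : ℕ) then 1 else 0) = 0 := by
    rw [← Finset.sum_sub_distrib]
    have : ∀ b, θ * (kap A n : ℤ) * shiftZ n (q.1 b) b -
        θ * (bigD A n : ℤ) * (if ((q.1 b : Fin (n + 1)) : ℕ) < (b : ℕ) then 1 else 0)
        = θ * ((kap A n : ℤ) * shiftZ n (q.1 b) b -
          (bigD A n : ℤ) * (if ((q.1 b : Fin (n + 1)) : ℕ) < (b : ℕ) then 1 else 0)) := fun b => by ring
    rw [Finset.sum_congr rfl (fun b _ => this b), ← Finset.mul_sum, h0, mul_zero]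
  linarith

/-! ### per-incidence scores -/

/-- the key identity behind the gauge: for a PRESENT incidence, `hi·D + κ·shift − D·[wrap] = κ·(effective shift)`. -/
theorem gauge_identity (a b : Fin (n + 1)) (l : Fin (2 * A + 2)) (h : ee A n a b l ≠ 0) :
    (hi A l : ℤ) * (bigD A n : ℤ) + (kap A n : ℤ) * shiftZ n a b -
      (bigD A n : ℤ) * (if (a : ℕ) < (b : ℕ) then 1 else 0) = (kap A n : ℤ) * eshift A n a b l := by
  have hD := bigD_cast A n
  have h01 := hi_le_one A l
  unfold eshift
  unfold ee at h
  by_cases hw : (a : ℕ) < (b : ℕ)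
  · rw [if_pos hw] at h
    have hh : hi A l = 1 := by by_contra hh; exact h (by rw [if_neg hh])
    have hne : ¬ ((a : ℕ) = (b : ℕ) ∧ hi A l = 1) := fun h' => by omega
    rw [if_neg hne, if_pos hw, hh]; push_cast; ring
  · rw [if_neg hw] at h
    rw [if_neg hw]
    by_cases hd : (a : ℕ) = (b : ℕ)
    · have hs : shiftZ n a b = 0 := by
        unfold ShiftThree.shiftZ; rw [if_neg hw]; omega
      by_cases hh : hi A l = 1
      · rw [if_pos ⟨hd, hh⟩, hh, hs, hD]; push_cast; ring
      · have hh0 : hi A l = 0 := by omega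
        rw [if_neg (fun h' => hh h'.2), hh0]; push_cast; ring
    · rw [if_neg hd] at h
      have hh : ¬ hi A l = 1 := fun hh => h (by rw [if_pos hh])
      have hh0 : hi A l = 0 := by omega
      rw [if_neg (fun h' => hd h'.1), hh0]; push_cast; ring

/-- score of a PRESENT incidence: `g_θ(effective shift) + bonus`. -/
theorem phi_present (θ : ℤ) (a b : Fin (n + 1)) (l : Fin (2 * A + 2)) (h : ee A n a b l ≠ 0) :
    phi A n θ a b l = gval A n θ (eshift A n a b l) + bonus A n θ (eshift A n a b l) b (lo A l) := by
  have hg := gauge_identity A n a b l h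
  unfold phi gval vv bonus
  rw [dd_cast]
  linear_combination θ * hg

/-! ### the grid incidences -/

/-- the low level lies in the window `(lvl − 1)·m + b < a ≤ lvl·m + b`. -/
theorem lvl_spec (a : ℕ) (b : Fin (n + 1)) :
    (n + 1) * lvl n a b + (b : ℕ) + 1 ≤ a + (n + 1) ∧ a ≤ (n + 1) * lvl n a b + (b : ℕ) := by
  unfold lvl
  have h := Nat.div_add_mod a (n + 1)
  have hc := Nat.mod_lt a (show 0 < n + 1 by omega)
  have hb := b.isLt
  by_cases hlt : (b : ℕ) < a % (n + 1)
  · rw [if_pos hlt, Nat.mul_succ]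
    constructor <;> omega
  · simp only [if_neg hlt, Nat.add_zero]
    constructor <;> omega

/-- the low level is at most `A` when `a ≤ A·m`. -/
theorem lvl_le (a : ℕ) (ha : a ≤ A * (n + 1)) (b : Fin (n + 1)) : lvl n a b ≤ A := by
  unfold lvl
  have h := Nat.div_add_mod a (n + 1)
  have hc := Nat.mod_lt a (show 0 < n + 1 by omega)
  have hi : a / (n + 1) ≤ A := by
    calc a / (n + 1) ≤ A * (n + 1) / (n + 1) := Nat.div_le_div_right ha
      _ = A := Nat.mul_div_cancel A (show 0 < n + 1 by omega)
  by_cases hlt : (b : ℕ) < a % (n + 1)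
  · rw [if_pos hlt]
    by_contra hcon
    have hA : a / (n + 1) = A := by omega
    have : (n + 1) * A + 1 ≤ a := by rw [← hA]; omega
    nlinarith
  · rw [if_neg hlt]; omega

/-- digits of the grid class: low level `min A (lvl a b)` … -/
theorem lo_lam (p a : ℕ) (b : Fin (n + 1)) : lo A (lam A n p a b) = min A (lvl n a b) := by
  unfold lo lam
  dsimp only
  rw [Nat.add_mul_mod_self_left, Nat.mod_eq_of_lt]
  exact Nat.lt_succ_of_le (min_le_left _ _)

/-- … and high bit `[m ≤ b + p]`. -/
theorem hi_lam (p a : ℕ) (b : Fin (n + 1)) : hi A (lam A n p a b) = if n + 1 ≤ (b : ℕ) + p then 1 else 0 := by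
  unfold hi lam
  dsimp only
  rw [Nat.add_mul_div_left _ _ (Nat.succ_pos A), Nat.div_eq_of_lt (Nat.lt_succ_of_le (min_le_left _ _)),
    Nat.zero_add]

/-- the effective shift of the grid incidence in column `b` is the phase `p ≤ m`. -/
theorem eshift_cterm (p a : ℕ) (hp : p ≤ n + 1) (b : Fin (n + 1)) :
    eshift A n (rot n p b) b (lam A n p a b) = p := by
  unfold eshift
  rw [hi_lam]
  rcases Nat.lt_or_eq_of_le hp with hp' | hp'
  · rw [if_neg, ShiftSquare.shiftZ_rot_of_lt n p hp' b]
    rintro ⟨h1, h2⟩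
    rw [ShiftSquare.rot_val n p hp] at h1
    by_cases hw : n + 1 ≤ (b : ℕ) + p
    · rw [if_pos hw] at h1; omega
    · rw [if_neg hw] at h2; exact absurd h2 (by decide)
  · subst hp'
    rw [if_pos]
    · push_cast; ring
    · exact ⟨ShiftSquare.rot_last_val n b, by rw [if_pos (by omega)]⟩

/-- the sign of the grid incidence in column `b` (every grid incidence is present). -/
theorem ee_cterm (p a : ℕ) (hp : p ≤ n + 1) (b : Fin (n + 1)) :
    ee A n (rot n p b) b (lam A n p a b) = lsign A n (lam A n p a b) := by
  have hv := ShiftSquare.rot_val n p hp b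
  have hh := hi_lam A n p a b
  unfold ee
  by_cases hw : n + 1 ≤ (b : ℕ) + p
  · rw [if_pos hw] at hh
    rw [if_pos hw] at hv
    rcases Nat.lt_or_eq_of_le hp with hp' | hp'
    · have hlt : ((rot n p b : Fin (n + 1)) : ℕ) < (b : ℕ) := by rw [hv]; omega
      rw [if_pos hlt, if_pos hh]
    · have heq : ((rot n p b : Fin (n + 1)) : ℕ) = (b : ℕ) := by rw [hv]; omega
      rw [if_neg (by omega), if_pos heq]
  · rw [if_neg hw] at hh
    rw [if_neg hw] at hv
    have hge : ¬ ((rot n p b : Fin (n + 1)) : ℕ) < (b : ℕ) := by rw [hv]; omega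
    rw [if_neg hge]
    by_cases heq : ((rot n p b : Fin (n + 1)) : ℕ) = (b : ℕ)
    · rw [if_pos heq]
    · rw [if_neg heq, if_neg (by rw [hh]; decide)]

/-- `|hsign| = 1`. -/
theorem hsign_natAbs : (hsign A n).natAbs = 1 := by
  unfold hsign; rw [Int.natAbs_pow, Int.natAbs_neg, Int.natAbs_one, one_pow]

/-- `|lsign l| = 1`. -/
theorem lsign_natAbs (l : Fin (2 * A + 2)) : (lsign A n l).natAbs = 1 := by
  unfold lsign
  rw [Int.natAbs_mul, Int.natAbs_pow, Int.natAbs_neg, Int.natAbs_one, one_pow, one_mul]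
  split_ifs
  · exact hsign_natAbs A n
  · rfl

/-- every incidence of a grid term is present. -/
theorem ee_cterm_ne_zero (p a : ℕ) (hp : p ≤ n + 1) (b : Fin (n + 1)) :
    ee A n (rot n p b) b (lam A n p a b) ≠ 0 := by
  rw [ee_cterm A n p a hp, ← Int.natAbs_ne_zero, lsign_natAbs]; exact one_ne_zero

/-- the design's signs lie in `{−1, 0, 1}`. -/
theorem ee_natAbs (a b : Fin (n + 1)) (l : Fin (2 * A + 2)) : (ee A n a b l).natAbs ≤ 1 := by
  unfold ee
  split_ifs <;> simp [lsign_natAbs]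

/-- score of the grid incidence in column `b` at slope `θ`: `g_θ(p) + bonus(θ, p, b, lvl)`, for `p ≤ m`, `a ≤ A·m`. -/
theorem phi_cterm (θ : ℤ) (p a : ℕ) (hp : p ≤ n + 1) (ha : a ≤ A * (n + 1)) (b : Fin (n + 1)) :
    phi A n θ (rot n p b) b (lam A n p a b) = gval A n θ p + bonus A n θ p b (lvl n a b) := by
  rw [phi_present A n θ _ b _ (ee_cterm_ne_zero A n p a hp b), eshift_cterm A n p a hp, lo_lam,
    min_eq_right (lvl_le A n a ha b)]

/-! ### the domination inequalities -/

/-- difference of shift scores, factored: `g(p) − g(q) = κ(p − q)(θ − W(p+q+1))`. -/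
theorem gval_sub (θ p q : ℤ) :
    gval A n θ p - gval A n θ q = (kap A n : ℤ) * (p - q) * (θ - (width A n : ℤ) * (p + q + 1)) := by
  unfold gval pen; ring

/-- a smaller shift loses more than `2AW·(p − q)`. -/
theorem gval_gap_of_lt (p a : ℕ) (q : ℤ) (hq : q < p) :
    2 * (A : ℤ) * (width A n : ℤ) * ((p : ℤ) - q) < gval A n (th A n p a) p - gval A n (th A n p a) q := by
  rw [gval_sub, kap_cast]
  unfold th
  have hW : (1 : ℤ) ≤ (width A n : ℤ) := by rw [width_cast]; nlinarith
  have h1 : (1 : ℤ) ≤ (p : ℤ) - q := by linarith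
  have hE : (1 : ℤ) ≤ 2 * (width A n : ℤ) * p + 2 * a + 1 - (width A n : ℤ) * (p + q + 1) := by
    have : 2 * (width A n : ℤ) * p + 2 * a + 1 - (width A n : ℤ) * (p + q + 1)
        = 1 + ((width A n : ℤ) * ((p : ℤ) - q - 1) + 2 * a) := by ring
    rw [this]
    nlinarith
  have hA : (0 : ℤ) ≤ 2 * (A : ℤ) * (width A n : ℤ) := by positivity
  nlinarith [mul_le_mul (le_refl ((2 * (A : ℤ) * (width A n : ℤ) + 1) * ((p : ℤ) - q))) hE (by norm_num)
    (by nlinarith)]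

/-- a larger (effective) shift loses outright, for every step `a ≤ A·m` of the phase. -/
theorem gval_gap_of_gt (p a : ℕ) (ha : a ≤ A * (n + 1)) (q : ℤ) (hq : (p : ℤ) < q) :
    0 < gval A n (th A n p a) p - gval A n (th A n p a) q := by
  rw [gval_sub]
  unfold th
  have hW := width_cast A n
  have h1 : (1 : ℤ) ≤ q - p := by linarith
  have ha' : (a : ℤ) ≤ (A : ℤ) * (n + 1) := by exact_mod_cast ha
  have hF : (1 : ℤ) ≤ (width A n : ℤ) * ((p : ℤ) + q + 1) - (2 * (width A n : ℤ) * p + 2 * a + 1) := by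
    rw [hW]; nlinarith
  have hk : (0 : ℤ) < (kap A n : ℤ) := by rw [kap_cast, hW]; positivity
  have h2 : (kap A n : ℤ) * (p - q) * (2 * (width A n : ℤ) * p + 2 * a + 1 - (width A n : ℤ) * (p + q + 1))
      = (kap A n : ℤ) * (q - p) * ((width A n : ℤ) * ((p : ℤ) + q + 1) - (2 * (width A n : ℤ) * p + 2 * a + 1)) := by
    ring
  rw [h2]
  positivity

/-- the bonus at another shift differs by `j·2W·(p − q)`. -/
theorem bonus_shift (θ : ℤ) (p q : ℤ) (b : Fin (n + 1)) (j : ℕ) :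
    bonus A n θ q b j = bonus A n θ p b j + (j : ℤ) * (2 * (width A n : ℤ) * (p - q)) := by
  unfold bonus priceSum; ring

/-- the bonus at the phase's own shift, factored: `bonus(j) − bonus(j') = (j − j')(2(a − b) − 1 − m(j + j' − 1))`. -/
theorem bonus_sub (p a : ℕ) (b : Fin (n + 1)) (j j' : ℕ) :
    bonus A n (th A n p a) p b j - bonus A n (th A n p a) p b j' =
      ((j : ℤ) - j') * (2 * ((a : ℤ) - b) - 1 - ((n : ℤ) + 1) * ((j : ℤ) + j' - 1)) := by
  unfold bonus priceSum th; ring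

/-- **the grid level is the unique best low level at the phase's shift** (weak form, all `j' ≤ A`) … -/
theorem bonus_le_lvl (p a : ℕ) (ha : a ≤ A * (n + 1)) (b : Fin (n + 1)) (j' : ℕ) :
    bonus A n (th A n p a) p b j' ≤ bonus A n (th A n p a) p b (lvl n a b) := by
  obtain ⟨h1, h2⟩ := lvl_spec n a b
  have hle := lvl_le A n a ha b
  set j := lvl n a b with hj
  have h1' : ((n : ℤ) + 1) * j + b + 1 ≤ a + (n + 1) := by exact_mod_cast h1
  have h2' : (a : ℤ) ≤ ((n : ℤ) + 1) * j + b := by exact_mod_cast h2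
  have hsub := bonus_sub A n p a b j j'
  have hn : (0 : ℤ) ≤ (n : ℤ) + 1 := by positivity
  rcases lt_trichotomy j' j with hlt | heq | hgt
  · have hjj : (j' : ℤ) + 1 ≤ j := by exact_mod_cast hlt
    have hB : ((n : ℤ) + 1) * ((j : ℤ) + j' - 1) ≤ ((n : ℤ) + 1) * (2 * j - 2) :=
      mul_le_mul_of_nonneg_left (by linarith) hn
    have hA1 : (1 : ℤ) ≤ (j : ℤ) - j' := by linarith
    have hA2 : (1 : ℤ) ≤ 2 * ((a : ℤ) - b) - 1 - ((n : ℤ) + 1) * ((j : ℤ) + j' - 1) := by linarith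
    have hm := mul_le_mul hA1 hA2 zero_le_one (by linarith)
    linarith
  · rw [heq]
  · have hjj : (j : ℤ) + 1 ≤ j' := by exact_mod_cast hgt
    have hB : ((n : ℤ) + 1) * (2 * j) ≤ ((n : ℤ) + 1) * ((j : ℤ) + j' - 1) :=
      mul_le_mul_of_nonneg_left (by linarith) hn
    have hA1 : (1 : ℤ) ≤ (j' : ℤ) - j := by linarith
    have hA2 : (1 : ℤ) ≤ -(2 * ((a : ℤ) - b) - 1 - ((n : ℤ) + 1) * ((j : ℤ) + j' - 1)) := by linarith
    have hm := mul_le_mul hA1 hA2 zero_le_one (by linarith)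
    linarith

/-- … and strict form. -/
theorem bonus_lt_lvl (p a : ℕ) (ha : a ≤ A * (n + 1)) (b : Fin (n + 1)) (j' : ℕ) (hne : j' ≠ lvl n a b) :
    bonus A n (th A n p a) p b j' < bonus A n (th A n p a) p b (lvl n a b) := by
  obtain ⟨h1, h2⟩ := lvl_spec n a b
  have hle := lvl_le A n a ha b
  set j := lvl n a b with hj
  have h1' : ((n : ℤ) + 1) * j + b + 1 ≤ a + (n + 1) := by exact_mod_cast h1
  have h2' : (a : ℤ) ≤ ((n : ℤ) + 1) * j + b := by exact_mod_cast h2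
  have hsub := bonus_sub A n p a b j j'
  have hn : (0 : ℤ) ≤ (n : ℤ) + 1 := by positivity
  rcases lt_trichotomy j' j with hlt | heq | hgt
  · have hjj : (j' : ℤ) + 1 ≤ j := by exact_mod_cast hlt
    have hB : ((n : ℤ) + 1) * ((j : ℤ) + j' - 1) ≤ ((n : ℤ) + 1) * (2 * j - 2) :=
      mul_le_mul_of_nonneg_left (by linarith) hn
    have hA1 : (1 : ℤ) ≤ (j : ℤ) - j' := by linarith
    have hA2 : (1 : ℤ) ≤ 2 * ((a : ℤ) - b) - 1 - ((n : ℤ) + 1) * ((j : ℤ) + j' - 1) := by linarith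
    have hm := mul_le_mul hA1 hA2 zero_le_one (by linarith)
    linarith
  · exact absurd heq hne
  · have hjj : (j : ℤ) + 1 ≤ j' := by exact_mod_cast hgt
    have hB : ((n : ℤ) + 1) * (2 * j) ≤ ((n : ℤ) + 1) * ((j : ℤ) + j' - 1) :=
      mul_le_mul_of_nonneg_left (by linarith) hn
    have hA1 : (1 : ℤ) ≤ (j' : ℤ) - j := by linarith
    have hA2 : (1 : ℤ) ≤ -(2 * ((a : ℤ) - b) - 1 - ((n : ℤ) + 1) * ((j : ℤ) + j' - 1)) := by linarith
    have hm := mul_le_mul hA1 hA2 zero_le_one (by linarith)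
    linarith

end ShiftLadder

end Summit.ValiantsHypothesis.ValiantsHypothesis.Theorems.LacunarySymmetroidMatrixDescartes.TropicalCensus
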